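import Mathlib
import HarnessLib
import Summits.Langlands.Langlands.Theses.SkinnerWilesDefectOne
import Summits.Langlands.Langlands.Theorems.SkinnerWilesDefectOneReducibleOrdinaryProModularDefs
import Summits.Langlands.Langlands.Theorems.SkinnerWilesDefectOneProModularOfEisensteinSeedProModularPrimes
import Literature.NumberTheory.GaloisRepresentations.NearlyOrdinaryDeformationRing

/-!
# Route `SkinnerWilesDefectOne`, crux `ReducibleOrdinaryProModular` (stmt-Langlands-12919): vocabulary of the
# line `fine-selmer-codimension-two`, lead skeleton v2

Second route-posited vocabulary file of the crux (D-0016 `<Route><Crux>Defs`-type; the first,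
`SkinnerWilesDefectOneReducibleOrdinaryProModularDefs.lean`, is at the 400-line cap).  It is shared by the seven
registered stubs of the lead skeleton `Cruxes/ReducibleOrdinaryProModular/Lines/fine_selmer_codimension_two.lean`
(v2, registered 2026-08-16 by `ledger skeleton check`: `stub_eisensteinSeed`, `stub_fineSelmerCodimTwo`,
`stub_seedPatchingPrime`, `stub_raynaudConnectivity`, `stub_patchingPrimeSupply`, `stub_descentFromPatchingPrime`,
`stub_largeResidualRank`) and by the crux file that will compose them.  NOTHING IS ASSERTED: every `def … : Prop` /
`structure … : Prop` below is a *statement* consumed only as (part of) the type of a stub or of the crux; the two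
lemmas are one-line unfoldings.  Declared in the crux's shared vocabulary namespace
`Summit.Langlands.Langlands.Cruxes.ReducibleOrdinaryProModular.SteinbergHyperplane` (where `ModelData` lives, so that
dot-notation `M.IsSWOriented`, `M.AtMostTwoAlignedPlaces` works), exactly as in the registered skeleton, so that a
landed stub reads byte-identically to its registration.

Objects (docstrings carry the mathematics; all over EXISTING tree vocabulary — `NearlyOrdinaryDeformationRing`
(`.reducibleLocus`, `.subChar`, `.quotChar`), `ModelData`, `IsProModularPrimeAt`, `TameLevel`, the route file):
* `SmallReducibleLocus 𝓡` — Z3: every reducible prime has `dim R/𝔮 ≤ 3`;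
* `IsProModularPrime 𝓡 𝔮` — pro-modular at SOME tame level (+ going-up `IsProModularPrime.of_le`);
* `IsPatchingPrime 𝓡 𝔭` — Skinner–Wiles' nice-minus-pro-modular primes, characteristic free;
* `IsBigPrime 𝓡 Q` — `dim R/Q ≥ 3` and irreducible (Raynaud's meeting primes at margin one);
* `ModelData.IsSWOriented` — the four Skinner–Wiles standing conditions of an oriented model (= the datum fields of
  `ModelData.Models`; `ModelData.Models.isSWOriented`);
* `ModelData.IsAlignedAt`, `ModelData.AtMostTwoAlignedPlaces` — the aligned places of the datum (`t ≤ 2` regime);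
* `SeedData p ρ₀ 𝒰 r r₀ q` — the body of the route's rank-3 crux `EisensteinProModularSeed` after its four
  existentials, VERBATIM, used only as a hypothesis (`eisensteinProModularSeed_iff : … := Iff.rfl` certifies it).

References: SkinnerWiles1999 §§2.2–2.3, 4.1–4.3; CalegariMazur2008 §2; the line card
`Cruxes/ReducibleOrdinaryProModular/Lines/fine-selmer-codimension-two.md`; lead gen 0's aligned-place count
(evidence `line-steinberg-hyperplane-S3-misstated.md` on the item).
-/

set_option linter.dupNamespace false
set_option autoImplicit false

namespace Summit.Langlands.Langlands.Cruxes.ReducibleOrdinaryProModular.SteinbergHyperplane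

open scoped NumberField MatrixGroups
open Filter NumberField IsDedekindDomain Field Matrix
open Literature.NumberTheory.Automorphic Literature.NumberTheory.Automorphic.BigHeckeGLn
open Literature.NumberTheory.GaloisRepresentations
open Summit.Langlands.Langlands.Theses.SkinnerWilesDefectOne

noncomputable section

variable {F : Type} [Field F] [NumberField F] {p : ℕ} [Fact p.Prime]
variable {𝒪 : Type} [CommRing 𝒪] {k : Type} [Field k] [Algebra 𝒪 k] {𝒟 : NearlyOrdinaryDatum F p 𝒪 k}

/-- **`Z3 = SmallReducibleLocus`** (the route's foreseen child; the lever's output): every prime of the reducible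
locus of `R_𝒟` has `dim R_𝒟/𝔮 ≤ 3 = dim Λ_F − l₀ − 1`. [folklore] -/
def SmallReducibleLocus (𝓡 : NearlyOrdinaryDeformationRing.{0} 𝒟) : Prop :=
  ∀ 𝔮 ∈ 𝓡.reducibleLocus, ringKrullDim (𝓡.R ⧸ 𝔮.asIdeal) ≤ 3

/-- **Pro-modular at SOME tame level** (the level floats: `bad` is upward closed, Disproof §7, and the depth at
`S` must be deep enough for the whole family). [folklore] -/
def IsProModularPrime (𝓡 : NearlyOrdinaryDeformationRing.{0} 𝒟) (𝔮 : PrimeSpectrum 𝓡.R) : Prop :=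
  ∃ 𝒰 : TameLevel 2 F p, IsProModularPrimeAt 𝓡 𝒰 𝔮

/-- Going up for "pro-modular at some level" (from the landed `IsProModularPrimeAt.of_le`, [SW, §4.1 p. 62]).
[cite: SkinnerWiles1999, §4.1] -/
theorem IsProModularPrime.of_le (𝓡 : NearlyOrdinaryDeformationRing.{0} 𝒟) {𝔮 𝔭 : PrimeSpectrum 𝓡.R} (h : 𝔮 ≤ 𝔭)
    (h𝔮 : IsProModularPrime 𝓡 𝔮) : IsProModularPrime 𝓡 𝔭 := by
  obtain ⟨𝒰, h𝒰⟩ := h𝔮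
  exact ⟨𝒰, IsProModularPrimeAt.of_le 𝓡 h h𝒰⟩

/-- **Patching prime** (the primes at which (P1) is run): `R_𝒟/𝔭` of Krull dimension one, `ρ_𝒟 mod 𝔭`
IRREDUCIBLE, and at every `v ∣ p` the nearly-ordinary inertial ratio `ψ₁⁽ᵛ⁾/ψ₂⁽ᵛ⁾ mod 𝔭` of infinite order —
Skinner–Wiles' nice-minus-pro-modular primes [SW, §2.3, §4.2] with the characteristic left free (char `p`:
SW; char `0`: an `𝒪'`-point, Kisin-style — needed because the seed is a characteristic-zero point).
[cite: SkinnerWiles1999, §2.3 and §4.2] -/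
def IsPatchingPrime (𝓡 : NearlyOrdinaryDeformationRing.{0} 𝒟) (𝔭 : PrimeSpectrum 𝓡.R) : Prop :=
  ringKrullDim (𝓡.R ⧸ 𝔭.asIdeal) = 1 ∧ 𝔭 ∉ 𝓡.reducibleLocus ∧
    ∀ (v : HeightOneSpectrum (𝓞 F)) (hv : (p : 𝓞 F) ∈ v.asIdeal),
      ¬ IsOfFinOrder ((Units.map (Ideal.Quotient.mk 𝔭.asIdeal : 𝓡.R →* 𝓡.R ⧸ 𝔭.asIdeal)).comp
        (𝓡.subChar v hv / 𝓡.quotChar v hv))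

/-- **Big prime** (where two components of different colours must meet for Raynaud's argument at margin one):
`dim R_𝒟/Q ≥ 3` and `Q` OUTSIDE the reducible locus (the margin-one clause: a 3-dimensional meeting locus must
not be a reducible sheet). [folklore] -/
def IsBigPrime (𝓡 : NearlyOrdinaryDeformationRing.{0} 𝒟) (Q : PrimeSpectrum 𝓡.R) : Prop :=
  3 ≤ ringKrullDim (𝓡.R ⧸ Q.asIdeal) ∧ Q ∉ 𝓡.reducibleLocus

variable (p) in
/-- **The Skinner–Wiles standing conditions of an oriented model**, datum-intrinsically: `ρ̄_𝒟` upper triangular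
in the standard basis, non-split with scalar centralizer, `p`-distinguished, and TRANSVERSE at every `v ∣ p`
(`(frame v)₁₀ ≠ 0`: the residual special line is not the global sub-line — the residual shadow of the crux's
orientation clause `‖Q₀₀‖ ≤ ‖Q₁₀‖`).  Exactly the four datum fields of `ModelData.Models`. [folklore] -/
structure ModelData.IsSWOriented (M : ModelData F p) : Prop where
  /-- `ρ̄_𝒟` is upper triangular in the standard basis (global sub-line `e₀`, character `χ̄₁`). [folklore] -/
  residual_upper : ∀ g, (M.𝒟.residual g).val 1 0 = 0
  /-- non-split with scalar centralizer (Mazur's hypothesis; BergerKlosin2012 Lemma 28). [folklore] -/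
  hasScalarCentralizer : M.𝒟.HasScalarCentralizer
  /-- `p`-distinguished at every `v ∣ p`. [folklore] -/
  isDistinguishedAt : ∀ v : HeightOneSpectrum (𝓞 F), (p : 𝓞 F) ∈ v.asIdeal → M.𝒟.IsDistinguishedAt v
  /-- transverse: the residual special line at `v ∣ p` is not the global sub-line. [folklore] -/
  oriented : ∀ v : HeightOneSpectrum (𝓞 F), (p : 𝓞 F) ∈ v.asIdeal → (M.𝒟.frame v).val 1 0 ≠ 0

/-- A model of `(ρ, ρ₀)` is SW-oriented. [folklore] -/
theorem ModelData.Models.isSWOriented {M : ModelData F p} {O : ValuationSubring (PadicAlgCl p)}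
    {ρ : FramedGaloisRep F (PadicAlgCl p) 2} {ρ₀ : absoluteGaloisGroup F →* GL (Fin 2) O}
    {S : Set (HeightOneSpectrum (𝓞 F))} (hM : M.Models ρ ρ₀ S) : M.IsSWOriented p :=
  ⟨hM.residual_upper, hM.hasScalarCentralizer, hM.isDistinguishedAt, hM.oriented⟩

variable (p) in
/-- **Aligned place of the datum** `M.𝒟` (datum-level form of the landed `IsAlignedPlace`): a place `v ∤ p` IN THE
LEVEL `S` at which the residual ratio is locally cyclotomic, `χ̄₁|_{D_v} = ω̄ · χ̄₂|_{D_v}` (read on `𝒟.residual`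
with `ω̄ = ε mod p` pushed into `k` through `ZMod p`).  These are the places whose tame Euler divisors
`{Ψ(Frob_v) = N v}` all pass through the fixed point `Ψ⁺ = ν̃ε`; each raises the rank of the split Selmer group at
`Ψ⁺` by one, so the `Ψ⁺`-stratum of the reducible locus has Krull dimension `t + 1`, `t` their number. [folklore] -/
def ModelData.IsAlignedAt (M : ModelData F p) (v : HeightOneSpectrum (𝓞 F)) : Prop :=
  v ∈ M.𝒟.S ∧ (p : 𝓞 F) ∉ v.asIdeal ∧
    ∀ σ : absoluteGaloisGroup (v.adicCompletion F),
      (M.𝒟.residual (absGaloisRestrict F (v.adicCompletion F) σ)).val 0 0 =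
        (ZMod.castHom (dvd_refl p) M.k
          (PadicInt.toZMod ((GaloisRep.cyclotomicCharacter F p
            (absGaloisRestrict F (v.adicCompletion F) σ) : ℤ_[p]ˣ) : ℤ_[p]))) *
          (M.𝒟.residual (absGaloisRestrict F (v.adicCompletion F) σ)).val 1 1

variable (p) in
/-- **At most two aligned places in the level** (`t ≤ 2`): the regime in which the fixed-point stratum `Ψ⁺` of the
reducible locus has Krull dimension `t + 1 ≤ 3`. [folklore] -/
def ModelData.AtMostTwoAlignedPlaces (M : ModelData F p) : Prop :=
  ∃ v₁ v₂ : HeightOneSpectrum (𝓞 F), ∀ v, M.IsAlignedAt p v → v = v₁ ∨ v = v₂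

variable (p) in
/-- **The seed's output for `(ρ₀; 𝒰, r, r₀, q)`** — the body of the route's rank-3 crux `EisensteinProModularSeed`
(stmt-Langlands-12920) VERBATIM after its four existentials: `r` irreducible and `p`-adically automorphic of level
`𝒰`, with an integral model `r₀` upper triangular mod `𝔪` having the SAME ordered residual diagonal as `ρ₀`,
oriented-ordinary of one parallel weight at every `v ∣ p`, and level-controlled away from the one auxiliary place `q`.
Used only as a HYPOTHESIS (of `stub_seedPatchingPrime`); `eisensteinProModularSeed_iff` certifies the transcription. -/
def SeedData {O : ValuationSubring (PadicAlgCl p)} (ρ₀ : absoluteGaloisGroup F →* GL (Fin 2) O)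
    (𝒰 : TameLevel 2 F p) (r : FramedGaloisRep F (PadicAlgCl p) 2) (r₀ : absoluteGaloisGroup F →* GL (Fin 2) O)
    (q : HeightOneSpectrum (𝓞 F)) : Prop :=
  r.toGaloisRep.IsIrreducible ∧ 𝒰.IsPadicallyAutomorphic r ∧ r.HasUpperTriangularIntegralModel r₀ ∧
    (∀ g, ((r₀ g).val 0 0 - (ρ₀ g).val 0 0 : O) ∈ IsLocalRing.maximalIdeal O ∧
      ((r₀ g).val 1 1 - (ρ₀ g).val 1 1 : O) ∈ IsLocalRing.maximalIdeal O) ∧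
    (∃ k : ℕ, 2 ≤ k ∧ ∃ m : ℕ, 0 < m ∧ ∀ v : HeightOneSpectrum (𝓞 F), (p : 𝓞 F) ∈ v.asIdeal →
      ∃ Q : Matrix.GeneralLinearGroup (Fin 2) (PadicAlgCl p), Valued.v (Q.val 0 0) ≤ Valued.v (Q.val 1 0) ∧
        ∀ σ, (Q⁻¹ * r.toLocal v σ * Q).val 1 0 = 0 ∧ (σ ∈ absInertia (v.adicCompletion F) →
          (Q⁻¹ * r.toLocal v σ * Q).val 1 1 ^ m = 1 ∧ (Q⁻¹ * r.toLocal v σ * Q).val 0 0 ^ m =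
            algebraMap (Padic p) (PadicAlgCl p) (((GaloisRep.cyclotomicCharacter (v.adicCompletion F) p σ).val :
              PadicInt p) : Padic p) ^ ((k - 1) * m))) ∧
    (∀ v : HeightOneSpectrum (𝓞 F), v ≠ q → (p : 𝓞 F) ∉ v.asIdeal →
      (∀ 𝔓 ∈ v.primesAbove, ∀ σ ∈ 𝔓.inertia (absoluteGaloisGroup F),
        ((ρ₀ σ).val 0 0 - 1 : O) ∈ IsLocalRing.maximalIdeal O ∧ ((ρ₀ σ).val 1 1 - 1 : O) ∈ IsLocalRing.maximalIdeal O) →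
      v ∉ 𝒰.bad)

/-- The seed crux re-read through `OrdLoc` / `SeedData`: definitional. [folklore] -/
theorem eisensteinProModularSeed_iff :
    EisensteinProModularSeed ↔
      ∀ (F : Type) [Field F] [NumberField F], IsTotallyComplex F → Module.finrank ℚ F = 2 →
        ∀ (p : ℕ) [Fact p.Prime], p ≠ 2 →
        ∀ (O : ValuationSubring (PadicAlgCl p)),
          O = (Valued.v : Valuation (PadicAlgCl p) NNReal).valuationSubring →
        ∀ (ρ : FramedGaloisRep F (PadicAlgCl p) 2) (ρ₀ : absoluteGaloisGroup F →* GL (Fin 2) O),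
          ρ.toGaloisRep.IsIrreducible → (∀ᶠ v in cofinite, ρ.IsUnramifiedAt v) →
          ρ.HasUpperTriangularIntegralModel ρ₀ → OrdLoc p O ρ ρ₀ →
          ∃ (𝒰 : TameLevel 2 F p) (r : FramedGaloisRep F (PadicAlgCl p) 2)
            (r₀ : absoluteGaloisGroup F →* GL (Fin 2) O) (q : HeightOneSpectrum (𝓞 F)), SeedData p ρ₀ 𝒰 r r₀ q :=
  Iff.rfl


end

end Summit.Langlands.Langlands.Cruxes.ReducibleOrdinaryProModular.SteinbergHyperplane
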